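import Mathlib
import Summits.Ventures.PercRepro2.V2SP
import Summits.Ventures.PercRepro2.Tail2DCount
import Summits.Ventures.PercRepro2.Tail2DThreePoint
import Summits.Ventures.PercRepro2.Tail2DP2Series
import Summits.Ventures.PercRepro2.Tail2DDisjointPaths
import Summits.Ventures.PercRepro2.Tail2DP2SeriesSP
import Summits.Ventures.PercRepro2.Tail2DAxisUnimodal
import Summits.Ventures.PercRepro2.Tail2DOffAxis31
import Summits.Ventures.PercRepro2.Tail2DOffAxis41

/-!
# Off the axis, third member: `T(5,1) ≤ T(4,2)` on every series–parallel network (seat mine-b, cell pub-perc-repro2)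

For every pattern `s` of the cell's grammar, uniformly two-coloured,

  `#{r ≥ 5 ∧ b ≥ 1} ≤ #{r ≥ 4 ∧ b ≥ 2}`   (`t51_le_t42`),

the member `(a, j) = (5, 1)` of the off-axis anti-diagonal unimodality `T(a, j) ≤ T(a−1, j+1)`.  Same
proof as for `(3,1)`, `(4,1)`: series multiplies the tails; for a parallel composition both tails are
bilinear in the capped cells of the factors (`K = 5`, `tail_par_rows`, `tail_cellsK`), and
`T(4,2) − T(5,1)` of the composition is the instance `a = 5` of the GENERAL certificate of the row `j = 1`
(registry §36.5; an exact identity of bilinear forms on symmetric arrays, verified for `3 ≤ a ≤ 9`):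

  `Σ_{k=3}^{a} [D₁(k,0)·Z₂(a+1−k) + Z₁(a+1−k)·D₂(k,0)] + Σ_{k=3}^{a} [D₁(k,1)·N₂(0,a−k) + N₁(0,a−k)·D₂(k,1)]
   + Σ_{k=2}^{a−1} [D₁(k,0)·D₂(a+1−k,0) + Z₁(k)·Z₂(a+1−k)]`,

`D(a, j) = T(a−1, j+1) − T(a, j)`, `Z(v) = #{r = 0, b ≥ v}`, `N(0,y) = #{r = 0, b = y}`: eighteen products of
non-negative factors, with the axis theorems `D(2,0) … D(5,0)`, the landed `D(3,1)`, `D(4,1)` and the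
induction hypothesis `D(5,1)` of the factors.
-/

namespace Summit.Ventures.PercRepro2.Tail2D

open V2Closure

set_option maxHeartbeats 1600000 in
/-- the parallel step of `T(5,1) ≤ T(4,2)` (the cell rewriting and the 18-product `linarith` need a larger
heartbeat budget than the `K = 4` member) -/
lemma t51_le_t42_par (s t : V2Closure.SP)
    (hs : (Finset.univ.filter (fun y : s.Conf => 5 ≤ s.rLab y ∧ 1 ≤ s.bLab y)).card
      ≤ (Finset.univ.filter (fun y : s.Conf => 4 ≤ s.rLab y ∧ 2 ≤ s.bLab y)).card)
    (ht : (Finset.univ.filter (fun y : t.Conf => 5 ≤ t.rLab y ∧ 1 ≤ t.bLab y)).card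
      ≤ (Finset.univ.filter (fun y : t.Conf => 4 ≤ t.rLab y ∧ 2 ≤ t.bLab y)).card) :
    (Finset.univ.filter (fun p : (V2Closure.SP.par s t).Conf =>
        5 ≤ (V2Closure.SP.par s t).rLab p ∧ 1 ≤ (V2Closure.SP.par s t).bLab p)).card
      ≤ (Finset.univ.filter (fun p : (V2Closure.SP.par s t).Conf =>
        4 ≤ (V2Closure.SP.par s t).rLab p ∧ 2 ≤ (V2Closure.SP.par s t).bLab p)).card := by
  -- the theorems for the factors: `D(2,0)`, `D(3,0)`, `D(4,0)`, `D(5,0)` (axis), `D(3,1)`, `D(4,1)`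
  have a2s := tail_axis_unimodal s 1
  have a3s := tail_axis_unimodal s 2
  have a4s := tail_axis_unimodal s 3
  have a5s := tail_axis_unimodal s 4
  have b31s := t31_le_t22 s
  have b41s := t41_le_t32 s
  have a2t := tail_axis_unimodal t 1
  have a3t := tail_axis_unimodal t 2
  have a4t := tail_axis_unimodal t 3
  have a5t := tail_axis_unimodal t 4
  have b31t := t31_le_t22 t
  have b41t := t41_le_t32 t
  rw [tail_b0] at a2s a2t a3s a3t a4s a4t a5s a5t
  -- everything in the cells (`K = 5`)
  rw [tail_cellsK s 5 5 1 (by norm_num) (by norm_num), tail_cellsK s 5 4 2 (by norm_num) (by norm_num)] at hs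
  rw [tail_cellsK s 5 2 0 (by norm_num) (by norm_num), tail_cellsK s 5 1 1 (by norm_num) (by norm_num)] at a2s
  rw [tail_cellsK s 5 3 0 (by norm_num) (by norm_num), tail_cellsK s 5 2 1 (by norm_num) (by norm_num)] at a3s
  rw [tail_cellsK s 5 4 0 (by norm_num) (by norm_num), tail_cellsK s 5 3 1 (by norm_num) (by norm_num)] at a4s
  rw [tail_cellsK s 5 5 0 (by norm_num) (by norm_num), tail_cellsK s 5 4 1 (by norm_num) (by norm_num)] at a5s
  rw [tail_cellsK s 5 3 1 (by norm_num) (by norm_num), tail_cellsK s 5 2 2 (by norm_num) (by norm_num)] at b31s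
  rw [tail_cellsK s 5 4 1 (by norm_num) (by norm_num), tail_cellsK s 5 3 2 (by norm_num) (by norm_num)] at b41s
  rw [tail_cellsK t 5 5 1 (by norm_num) (by norm_num), tail_cellsK t 5 4 2 (by norm_num) (by norm_num)] at ht
  rw [tail_cellsK t 5 2 0 (by norm_num) (by norm_num), tail_cellsK t 5 1 1 (by norm_num) (by norm_num)] at a2t
  rw [tail_cellsK t 5 3 0 (by norm_num) (by norm_num), tail_cellsK t 5 2 1 (by norm_num) (by norm_num)] at a3t
  rw [tail_cellsK t 5 4 0 (by norm_num) (by norm_num), tail_cellsK t 5 3 1 (by norm_num) (by norm_num)] at a4t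
  rw [tail_cellsK t 5 5 0 (by norm_num) (by norm_num), tail_cellsK t 5 4 1 (by norm_num) (by norm_num)] at a5t
  rw [tail_cellsK t 5 3 1 (by norm_num) (by norm_num), tail_cellsK t 5 2 2 (by norm_num) (by norm_num)] at b31t
  rw [tail_cellsK t 5 4 1 (by norm_num) (by norm_num), tail_cellsK t 5 3 2 (by norm_num) (by norm_num)] at b41t
  rw [tail_par_rows s t 5 5 1 (by norm_num) (by norm_num), tail_par_rows s t 5 4 2 (by norm_num) (by norm_num)]
  simp only [Finset.sum_range_succ, Finset.sum_range_zero]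
  rw [tail_cellsK t 5 5 1 (by norm_num) (by norm_num),
    tail_cellsK t 5 5 0 (by norm_num) (by norm_num),
    tail_cellsK t 5 4 2 (by norm_num) (by norm_num),
    tail_cellsK t 5 4 1 (by norm_num) (by norm_num),
    tail_cellsK t 5 4 0 (by norm_num) (by norm_num),
    tail_cellsK t 5 3 2 (by norm_num) (by norm_num),
    tail_cellsK t 5 3 1 (by norm_num) (by norm_num),
    tail_cellsK t 5 3 0 (by norm_num) (by norm_num),
    tail_cellsK t 5 2 2 (by norm_num) (by norm_num),
    tail_cellsK t 5 2 1 (by norm_num) (by norm_num),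
    tail_cellsK t 5 2 0 (by norm_num) (by norm_num),
    tail_cellsK t 5 1 2 (by norm_num) (by norm_num),
    tail_cellsK t 5 1 1 (by norm_num) (by norm_num),
    tail_cellsK t 5 1 0 (by norm_num) (by norm_num),
    tail_cellsK t 5 0 2 (by norm_num) (by norm_num),
    tail_cellsK t 5 0 1 (by norm_num) (by norm_num),
    tail_cellsK t 5 0 0 (by norm_num) (by norm_num)]
  simp only [Finset.sum_range_succ, Finset.sum_range_zero] at hs ht a2s a2t a3s a3t a4s a4t a5s a5t b31s b31t b41s b41t ⊢
  norm_num at hs ht a2s a2t a3s a3t a4s a4t a5s a5t b31s b31t b41s b41t ⊢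
  -- mirror cells
  rw [cellCount_symm s 5 1 0, cellCount_symm s 5 2 0, cellCount_symm s 5 2 1, cellCount_symm s 5 3 0, cellCount_symm s 5 3 1, cellCount_symm s 5 3 2, cellCount_symm s 5 4 0, cellCount_symm s 5 4 1, cellCount_symm s 5 4 2, cellCount_symm s 5 4 3, cellCount_symm s 5 5 0, cellCount_symm s 5 5 1, cellCount_symm s 5 5 2, cellCount_symm s 5 5 3, cellCount_symm s 5 5 4, cellCount_symm t 5 1 0, cellCount_symm t 5 2 0, cellCount_symm t 5 2 1, cellCount_symm t 5 3 0, cellCount_symm t 5 3 1, cellCount_symm t 5 3 2, cellCount_symm t 5 4 0, cellCount_symm t 5 4 1, cellCount_symm t 5 4 2, cellCount_symm t 5 4 3, cellCount_symm t 5 5 0, cellCount_symm t 5 5 1, cellCount_symm t 5 5 2, cellCount_symm t 5 5 3, cellCount_symm t 5 5 4] at *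
  -- the certificate (registry §36.5, `a = 5`)
  zify at hs ht a2s a2t a3s a3t a4s a4t a5s a5t b31s b31t b41s b41t ⊢
  have h1 := mul_nonneg (sub_nonneg.2 a3s) (by positivity : (0 : ℤ) ≤ cellCount t 5 0 3 + cellCount t 5 0 4 + cellCount t 5 0 5)
  have h2 := mul_nonneg (by positivity : (0 : ℤ) ≤ cellCount s 5 0 3 + cellCount s 5 0 4 + cellCount s 5 0 5) (sub_nonneg.2 a3t)
  have h3 := mul_nonneg (sub_nonneg.2 a4s) (by positivity : (0 : ℤ) ≤ cellCount t 5 0 2 + cellCount t 5 0 3 + cellCount t 5 0 4 + cellCount t 5 0 5)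
  have h4 := mul_nonneg (by positivity : (0 : ℤ) ≤ cellCount s 5 0 2 + cellCount s 5 0 3 + cellCount s 5 0 4 + cellCount s 5 0 5) (sub_nonneg.2 a4t)
  have h5 := mul_nonneg (sub_nonneg.2 a5s) (by positivity : (0 : ℤ) ≤ cellCount t 5 0 1 + cellCount t 5 0 2 + cellCount t 5 0 3 + cellCount t 5 0 4 + cellCount t 5 0 5)
  have h6 := mul_nonneg (by positivity : (0 : ℤ) ≤ cellCount s 5 0 1 + cellCount s 5 0 2 + cellCount s 5 0 3 + cellCount s 5 0 4 + cellCount s 5 0 5) (sub_nonneg.2 a5t)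
  have h7 := mul_nonneg (sub_nonneg.2 b31s) (by positivity : (0 : ℤ) ≤ cellCount t 5 0 2)
  have h8 := mul_nonneg (by positivity : (0 : ℤ) ≤ cellCount s 5 0 2) (sub_nonneg.2 b31t)
  have h9 := mul_nonneg (sub_nonneg.2 b41s) (by positivity : (0 : ℤ) ≤ cellCount t 5 0 1)
  have h10 := mul_nonneg (by positivity : (0 : ℤ) ≤ cellCount s 5 0 1) (sub_nonneg.2 b41t)
  have h11 := mul_nonneg (sub_nonneg.2 hs) (by positivity : (0 : ℤ) ≤ cellCount t 5 0 0)
  have h12 := mul_nonneg (by positivity : (0 : ℤ) ≤ cellCount s 5 0 0) (sub_nonneg.2 ht)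
  have h13 := mul_nonneg (sub_nonneg.2 a2s) (sub_nonneg.2 a4t)
  have h14 := mul_nonneg (sub_nonneg.2 a3s) (sub_nonneg.2 a3t)
  have h15 := mul_nonneg (sub_nonneg.2 a4s) (sub_nonneg.2 a2t)
  have h16 := mul_nonneg (by positivity : (0 : ℤ) ≤ cellCount s 5 0 2 + cellCount s 5 0 3 + cellCount s 5 0 4 + cellCount s 5 0 5) (by positivity : (0 : ℤ) ≤ cellCount t 5 0 4 + cellCount t 5 0 5)
  have h17 := mul_nonneg (by positivity : (0 : ℤ) ≤ cellCount s 5 0 3 + cellCount s 5 0 4 + cellCount s 5 0 5) (by positivity : (0 : ℤ) ≤ cellCount t 5 0 3 + cellCount t 5 0 4 + cellCount t 5 0 5)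
  have h18 := mul_nonneg (by positivity : (0 : ℤ) ≤ cellCount s 5 0 4 + cellCount s 5 0 5) (by positivity : (0 : ℤ) ≤ cellCount t 5 0 2 + cellCount t 5 0 3 + cellCount t 5 0 4 + cellCount t 5 0 5)
  linarith [h1, h2, h3, h4, h5, h6, h7, h8, h9, h10, h11, h12, h13, h14, h15, h16, h17, h18]

/-- **five disjoint red paths with a blue path are rarer than four disjoint red paths with two
disjoint blue paths**, on every pattern of the grammar: `T(5,1) ≤ T(4,2)` -/
theorem t51_le_t42 : ∀ s : V2Closure.SP,
    (Finset.univ.filter (fun y : s.Conf => 5 ≤ s.rLab y ∧ 1 ≤ s.bLab y)).card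
      ≤ (Finset.univ.filter (fun y : s.Conf => 4 ≤ s.rLab y ∧ 2 ≤ s.bLab y)).card
  | .free => by decide
  | .pin => by decide
  | .absent => by decide
  | .ser s t => by
    rw [card_tail_ser, card_tail_ser]
    exact Nat.mul_le_mul (t51_le_t42 s) (t51_le_t42 t)
  | .par s t => t51_le_t42_par s t (t51_le_t42 s) (t51_le_t42 t)

/-- the same in the vocabulary of `Tail2DP2Series` -/
theorem stat_t51_le_t42 (s : V2Closure.SP) :
    stat s (fun r b => 5 ≤ r ∧ 1 ≤ b) ≤ stat s (fun r b => 4 ≤ r ∧ 2 ≤ b) :=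
  t51_le_t42 s

end Summit.Ventures.PercRepro2.Tail2D
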